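import Summits.ABC.IUTFork.Thm311RealInd1StripTwistLatticeMulti
import Mathlib.GroupTheory.Index
import Mathlib.LinearAlgebra.Pi
import Mathlib.LinearAlgebra.Prod
import HarnessLib

/-!
# Index bookkeeping for lattices stable under the transvection pairs of several twist planes:
# `[Λ : Λ'] = [P : P']² · [R : R']` (plane part squared times plane-free remainder)

PROOF-ONLY, Mathlib-only helper (abc-iut cell, Cor. 3.12 sub-crew, seat abc-iut-c312-1 = holder of record of the typed
[IUTchIII] Thm. 3.11, gen 10; row «R11 IND1-STRIP-MOVER-ALL-PLANES», successor brick of gen 9's kit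
`staging/c312/c312-1/g9/NEXT-ALL-PLANES.md`).  TAKES NO SIDE on [IUTchIII] Cor. 3.12.

Setting of `Thm311RealInd1StripTwistLatticeMulti`: a module `V` over a commutative ring `R`, a finite family of twist
planes `i : ι` with vectors `ya i, yb i` and coordinate functionals `ca i, cb i` satisfying the Kronecker dualities, and
additive subgroups `Λ' ≤ Λ` of `V` that are BOTH stable under both elementary transvections of every plane
(Jannsen–Wingberg: K. Kondo, arXiv:2512.09231 §2; the named fact `DehnTwistTransvectionsOnUnitsAll`).  Write
`κa := (ca i)_i : V → R^ι`, `κ := ((ca i)_i, (cb i)_i) : V → R^ι × R^ι`, `P(Λ) := κa(Λ)` (plane coefficient group) and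
`R(Λ) := Λ ∩ ker κ` (plane-free remainder).  Proved here (classical group theory, no definitions):
* `relIndex_prod`, `relIndex_pi` — the relative index of a product of subgroups is the product of the relative indices;
* `map_pi_cb_eq_map_pi_ca` — `κb(Λ) = κa(Λ)` (one coefficient group per plane), `map_prod_pi_eq` — `κ(Λ) = P(Λ) × P(Λ)`,
  `map_pi_ca_eq_pi` — `P(Λ) = ∏_i A_i(Λ)` with `A_i(Λ) = {r | r • ya i ∈ Λ}`;
* `sup_inf_ker_eq` — `Λ' ⊔ R(Λ) = Λ ∩ κ⁻¹(κ Λ')` for `Λ' ≤ Λ`;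
* **`relIndex_eq_sq_mul`** — `[Λ : Λ'] = [P(Λ) : P(Λ')]² · [R(Λ) : R(Λ')]`;
* `relIndex_chain_eq_prod` — `[Λ 0 : Λ e] = ∏_{m<e} [Λ m : Λ (m+1)]` along a decreasing chain.
Consumed by `Thm311RealInd1StripTwistMoverOdd` (the parity obstruction `f` odd).  Classical linear algebra; nothing here is
disputed mathematics.  [cite: NeukirchSchmidtWingberg2008, Thm 7.5.14]
-/

namespace Summit.ABC.IUTFork.Thm311.TwistLattice

open Finset

/-! ## 1. Relative index of products -/

section Prod

variable {A B : Type*} [AddGroup A] [AddGroup B]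

/-- **`[H × K : H' × K'] = [H : H'] · [K : K']`** for additive subgroups `H', H ≤ A`, `K', K ≤ B` (relative indices;
`0 = ∞` convention on both sides). [folklore] -/
theorem relIndex_prod (H' H : AddSubgroup A) (K' K : AddSubgroup B) :
    (H'.prod K').relIndex (H.prod K) = H'.relIndex H * K'.relIndex K := by
  let f : H × K →+ A × B := AddMonoidHom.prodMap H.subtype K.subtype
  have hrange : f.range = H.prod K := by
    ext x
    constructor
    · rintro ⟨y, rfl⟩
      exact AddSubgroup.mem_prod.mpr ⟨(y.1).2, (y.2).2⟩
    · intro hx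
      rw [AddSubgroup.mem_prod] at hx
      exact ⟨(⟨x.1, hx.1⟩, ⟨x.2, hx.2⟩), rfl⟩
  have hcomap : (H'.prod K').comap f = (H'.addSubgroupOf H).prod (K'.addSubgroupOf K) := by
    ext y
    rw [AddSubgroup.mem_comap, AddSubgroup.mem_prod, AddSubgroup.mem_prod, AddSubgroup.mem_addSubgroupOf,
      AddSubgroup.mem_addSubgroupOf]
    exact Iff.rfl
  calc (H'.prod K').relIndex (H.prod K) = (H'.prod K').relIndex f.range := by rw [hrange]
    _ = ((H'.prod K').comap f).index := (AddSubgroup.index_comap _ _).symm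
    _ = ((H'.addSubgroupOf H).prod (K'.addSubgroupOf K)).index := by rw [hcomap]
    _ = H'.relIndex H * K'.relIndex K := AddSubgroup.index_prod _ _

/-- The index of a product of subgroups is the product of the indices — dependent version of Mathlib's
`AddSubgroup.index_pi` (same proof; the tree has it only as a `private` lemma elsewhere). [folklore] -/
theorem index_pi_dep {κ : Type*} [Fintype κ] {β : κ → Type*} [∀ i, AddGroup (β i)]
    (H : ∀ i, AddSubgroup (β i)) : (AddSubgroup.pi Set.univ H).index = ∏ i, (H i).index := by
  simp_rw [AddSubgroup.index, ← Nat.card_pi]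
  refine Nat.card_congr
    ((Quotient.congrRight (fun x y ↦ ?_)).trans (Setoid.piQuotientEquiv _).symm)
  rw [QuotientAddGroup.leftRel_pi]

/-- **`[∏ H_i : ∏ H'_i] = ∏ [H_i : H'_i]`** for families of additive subgroups over a finite index type. [folklore] -/
theorem relIndex_pi {ι : Type*} [Fintype ι] {G : Type*} [AddGroup G] (H' H : ι → AddSubgroup G) :
    (AddSubgroup.pi Set.univ H').relIndex (AddSubgroup.pi Set.univ H) = ∏ i, (H' i).relIndex (H i) := by
  let f : (Π i, H i) →+ (ι → G) :=
    { toFun := fun x i => ((x i : H i) : G), map_zero' := rfl, map_add' := fun _ _ => rfl }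
  have hrange : f.range = AddSubgroup.pi Set.univ H := by
    ext x
    constructor
    · rintro ⟨y, rfl⟩
      exact fun i _ => (y i).2
    · intro hx
      exact ⟨fun i => ⟨x i, hx i (Set.mem_univ i)⟩, rfl⟩
  have hcomap : (AddSubgroup.pi Set.univ H').comap f =
      AddSubgroup.pi Set.univ (fun i => (H' i).addSubgroupOf (H i)) := by
    ext y
    rw [AddSubgroup.mem_comap, AddSubgroup.mem_pi, AddSubgroup.mem_pi]
    exact Iff.rfl
  calc (AddSubgroup.pi Set.univ H').relIndex (AddSubgroup.pi Set.univ H)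
        = (AddSubgroup.pi Set.univ H').relIndex f.range := by rw [hrange]
    _ = ((AddSubgroup.pi Set.univ H').comap f).index := (AddSubgroup.index_comap _ _).symm
    _ = (AddSubgroup.pi Set.univ (fun i => (H' i).addSubgroupOf (H i))).index := by rw [hcomap]
    _ = ∏ i, ((H' i).addSubgroupOf (H i)).index := index_pi_dep _
    _ = ∏ i, (H' i).relIndex (H i) := Finset.prod_congr rfl fun i _ => rfl

/-- **Second isomorphism theorem, index form**: for `Λ' ≤ Λ` and an additive homomorphism `f`,
`Λ' ⊔ (Λ ∩ ker f) = Λ ∩ f⁻¹(f Λ')`. [folklore] -/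
theorem sup_inf_ker_eq {G G' : Type*} [AddCommGroup G] [AddCommGroup G'] (f : G →+ G')
    {Λ' Λ : AddSubgroup G} (hle : Λ' ≤ Λ) : Λ' ⊔ (Λ ⊓ f.ker) = Λ ⊓ (Λ'.map f).comap f := by
  apply le_antisymm
  · refine sup_le (fun x hx => AddSubgroup.mem_inf.mpr ⟨hle hx, ?_⟩)
      (fun x hx => AddSubgroup.mem_inf.mpr ⟨(AddSubgroup.mem_inf.mp hx).1, ?_⟩)
    · exact AddSubgroup.mem_comap.mpr ⟨x, hx, rfl⟩
    · have hx0 : f x = 0 := (AddMonoidHom.mem_ker).mp (AddSubgroup.mem_inf.mp hx).2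
      rw [AddSubgroup.mem_comap, hx0]
      exact zero_mem _
  · intro x hx
    obtain ⟨hxΛ, hx⟩ := AddSubgroup.mem_inf.mp hx
    rw [AddSubgroup.mem_comap, AddSubgroup.mem_map] at hx
    obtain ⟨y, hy, hyx⟩ := hx
    rw [show x = y + (x - y) from (add_sub_cancel y x).symm]
    refine AddSubgroup.add_mem _ (AddSubgroup.mem_sup_left hy) (AddSubgroup.mem_sup_right ?_)
    refine AddSubgroup.mem_inf.mpr ⟨Λ.sub_mem hxΛ (hle hy), ?_⟩
    rw [AddMonoidHom.mem_ker, map_sub, hyx, sub_self]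

/-- Along a decreasing chain, `Λ e ≤ Λ 0`. [folklore] -/
theorem chain_le_zero {G : Type*} [AddGroup G] (Λ : ℕ → AddSubgroup G) (e : ℕ)
    (hanti : ∀ m < e, Λ (m + 1) ≤ Λ m) : Λ e ≤ Λ 0 := by
  induction e with
  | zero => exact le_rfl
  | succ e ih =>
    exact (hanti e (Nat.lt_succ_self e)).trans (ih fun m hm => hanti m (Nat.lt_succ_of_lt hm))

/-- **Indices multiply along a decreasing chain**: `[Λ 0 : Λ e] = ∏_{m<e} [Λ m : Λ (m+1)]`. [folklore] -/
theorem relIndex_chain_eq_prod {G : Type*} [AddGroup G] (Λ : ℕ → AddSubgroup G) (e : ℕ)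
    (hanti : ∀ m < e, Λ (m + 1) ≤ Λ m) :
    (Λ e).relIndex (Λ 0) = ∏ m ∈ Finset.range e, (Λ (m + 1)).relIndex (Λ m) := by
  induction e with
  | zero => rw [Finset.prod_range_zero, AddSubgroup.relIndex_self]
  | succ e ih =>
    have hanti' : ∀ m < e, Λ (m + 1) ≤ Λ m := fun m hm => hanti m (Nat.lt_succ_of_lt hm)
    rw [Finset.prod_range_succ, ← ih hanti', mul_comm,
      AddSubgroup.relIndex_mul_relIndex (Λ (e + 1)) (Λ e) (Λ 0) (hanti e (Nat.lt_succ_self e))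
        (chain_le_zero Λ e hanti')]

end Prod

/-! ## 2. `κ(Λ) = P(Λ) × P(Λ)` and `[Λ : Λ'] = [P : P']² · [R : R']` -/

section Index

variable {R : Type*} [CommRing R] {V : Type*} [AddCommGroup V] [Module R V]
variable {ι : Type*} [Fintype ι] [DecidableEq ι]
variable {ca cb : ι → (V →ₗ[R] R)} {ya yb : ι → V}
variable (haa : ∀ i j, ca i (ya j) = if i = j then 1 else 0) (hbb : ∀ i j, cb i (yb j) = if i = j then 1 else 0)
variable (hab : ∀ i j, ca i (yb j) = 0) (hba : ∀ i j, cb i (ya j) = 0)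

include haa hab in
/-- Coordinates of a plane combination, `a`-half: `ca j (Σ_i (r i • ya i + s i • yb i)) = r j`. [folklore] -/
theorem ca_sum_smul (r s : ι → R) (j : ι) : ca j (∑ i, (r i • ya i + s i • yb i)) = r j := by
  simp only [map_sum, map_add, map_smul, smul_eq_mul, haa, hab, mul_zero, add_zero]
  rw [Finset.sum_eq_single j]
  · rw [if_pos rfl, mul_one]
  · intro i _ hij
    rw [if_neg (Ne.symm hij), mul_zero]
  · intro hj
    exact absurd (Finset.mem_univ j) hj

include hbb hba in
/-- Coordinates of a plane combination, `b`-half: `cb j (Σ_i (r i • ya i + s i • yb i)) = s j`. [folklore] -/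
theorem cb_sum_smul (r s : ι → R) (j : ι) : cb j (∑ i, (r i • ya i + s i • yb i)) = s j := by
  simp only [map_sum, map_add, map_smul, smul_eq_mul, hbb, hba, mul_zero, zero_add]
  rw [Finset.sum_eq_single j]
  · rw [if_pos rfl, mul_one]
  · intro i _ hij
    rw [if_neg (Ne.symm hij), mul_zero]
  · intro hj
    exact absurd (Finset.mem_univ j) hj

variable {Λ : AddSubgroup V}
variable (hΛ : ∀ i, (∀ v ∈ Λ, v + cb i v • ya i ∈ Λ) ∧ (∀ v ∈ Λ, v - ca i v • yb i ∈ Λ))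

include hΛ haa hbb hab hba in
/-- **One coefficient group per plane, family form**: `κb(Λ) = κa(Λ)` in `R^ι`. [folklore] -/
theorem map_pi_cb_eq_map_pi_ca :
    Λ.map (LinearMap.pi cb).toAddMonoidHom = Λ.map (LinearMap.pi ca).toAddMonoidHom := by
  apply le_antisymm
  · rintro _ ⟨x, hx, rfl⟩
    -- the `b`-coefficients of `x`, placed on the `a`-vectors
    refine ⟨∑ i, (cb i x • ya i + (0 : ι → R) i • yb i), Λ.sum_mem fun i _ => ?_, ?_⟩
    · rw [Pi.zero_apply, zero_smul, add_zero]
      exact (smul_yb_mem_iff_of_all hΛ haa hbb i _).mp (smul_yb_mem_of_all hΛ haa i hx)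
    · funext j
      rw [LinearMap.toAddMonoidHom_coe, LinearMap.toAddMonoidHom_coe, LinearMap.pi_apply,
        LinearMap.pi_apply]
      exact ca_sum_smul haa hab (fun i => cb i x) 0 j
  · rintro _ ⟨x, hx, rfl⟩
    refine ⟨∑ i, ((0 : ι → R) i • ya i + ca i x • yb i), Λ.sum_mem fun i _ => ?_, ?_⟩
    · rw [Pi.zero_apply, zero_smul, zero_add]
      exact (smul_yb_mem_iff_of_all hΛ haa hbb i _).mpr (smul_ya_mem_of_all hΛ hbb i hx)
    · funext j
      rw [LinearMap.toAddMonoidHom_coe, LinearMap.toAddMonoidHom_coe, LinearMap.pi_apply,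
        LinearMap.pi_apply]
      exact cb_sum_smul hbb hba 0 (fun i => ca i x) j

include hΛ haa hbb hab hba in
/-- **`κ(Λ) = P(Λ) × P(Λ)`**: the image of a twist-stable `Λ` under both coordinate halves is the square of its plane
coefficient group `P(Λ) = κa(Λ)`. [folklore] -/
theorem map_prod_pi_eq :
    Λ.map ((LinearMap.pi ca).prod (LinearMap.pi cb)).toAddMonoidHom =
      (Λ.map (LinearMap.pi ca).toAddMonoidHom).prod (Λ.map (LinearMap.pi ca).toAddMonoidHom) := by
  apply le_antisymm
  · rintro _ ⟨x, hx, rfl⟩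
    rw [AddSubgroup.mem_prod]
    refine ⟨⟨x, hx, rfl⟩, ?_⟩
    rw [← map_pi_cb_eq_map_pi_ca haa hbb hab hba hΛ]
    exact ⟨x, hx, rfl⟩
  · rintro ⟨a, b⟩ hab'
    rw [AddSubgroup.mem_prod] at hab'
    obtain ⟨⟨x, hx, hxa⟩, hb⟩ := hab'
    rw [← map_pi_cb_eq_map_pi_ca haa hbb hab hba hΛ] at hb
    obtain ⟨x', hx', hx'b⟩ := hb
    refine ⟨∑ i, (ca i x • ya i + cb i x' • yb i),
      Λ.sum_mem fun i _ => Λ.add_mem (smul_ya_mem_of_all hΛ hbb i hx) (smul_yb_mem_of_all hΛ haa i hx'), ?_⟩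
    refine Prod.ext ?_ ?_
    · funext j
      rw [← hxa]
      change ca j _ = ca j x
      exact ca_sum_smul haa hab (fun i => ca i x) (fun i => cb i x') j
    · funext j
      rw [← hx'b]
      change cb j _ = cb j x'
      exact cb_sum_smul hbb hba (fun i => ca i x) (fun i => cb i x') j

include hΛ haa hbb in
/-- **`P(Λ) = ∏_i A_i(Λ)`**: the plane coefficient group is the product of the per-plane coefficient groups
`A_i(Λ) = {r | r • ya i ∈ Λ}`. [folklore] -/
theorem map_pi_ca_eq_pi :
    Λ.map (LinearMap.pi ca).toAddMonoidHom =
      AddSubgroup.pi Set.univ (fun i => Λ.comap (LinearMap.toSpanSingleton R V (ya i)).toAddMonoidHom) := by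
  apply le_antisymm
  · rintro _ ⟨x, hx, rfl⟩
    rw [AddSubgroup.mem_pi]
    intro i _
    rw [AddSubgroup.mem_comap, LinearMap.toAddMonoidHom_coe, LinearMap.toAddMonoidHom_coe, LinearMap.pi_apply,
      LinearMap.toSpanSingleton_apply]
    exact smul_ya_mem_of_all hΛ hbb i hx
  · intro r hr
    rw [AddSubgroup.mem_pi] at hr
    refine ⟨∑ i, (r i • ya i + (0 : ι → R) i • yb i), Λ.sum_mem fun i _ => ?_, ?_⟩
    · rw [Pi.zero_apply, zero_smul, add_zero]
      have h := hr i (Set.mem_univ i)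
      rw [AddSubgroup.mem_comap, LinearMap.toAddMonoidHom_coe, LinearMap.toSpanSingleton_apply] at h
      exact h
    · funext j
      rw [LinearMap.toAddMonoidHom_coe, LinearMap.pi_apply]
      simp only [Pi.zero_apply, zero_smul, add_zero, map_sum, map_smul, smul_eq_mul, haa, mul_ite, mul_one, mul_zero]
      rw [Finset.sum_eq_single j, if_pos rfl]
      · intro i _ hij
        rw [if_neg (Ne.symm hij)]
      · intro hj
        exact absurd (Finset.mem_univ j) hj

include hΛ haa hbb hab hba in
/-- **`[Λ : Λ'] = [P(Λ) : P(Λ')]² · [R(Λ) : R(Λ')]`** for twist-stable `Λ' ≤ Λ` (all planes): the relative index splits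
as the SQUARE of the index of plane coefficient groups times the index of the plane-free remainders
`R(·) = · ∩ ker κ`.  (`[Λ : Λ'] = [Λ : Λ' ⊔ R(Λ)] · [Λ' ⊔ R(Λ) : Λ']`; the second factor is `[R(Λ) : R(Λ')]` by the second
isomorphism theorem, the first is `[κΛ : κΛ'] = [P × P : P' × P']`.) [folklore] -/
theorem relIndex_eq_sq_mul {Λ' : AddSubgroup V} (hle : Λ' ≤ Λ)
    (hΛ' : ∀ i, (∀ v ∈ Λ', v + cb i v • ya i ∈ Λ') ∧ (∀ v ∈ Λ', v - ca i v • yb i ∈ Λ')) :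
    Λ'.relIndex Λ =
      ((Λ'.map (LinearMap.pi ca).toAddMonoidHom).relIndex (Λ.map (LinearMap.pi ca).toAddMonoidHom)) ^ 2 *
        (Λ' ⊓ ((LinearMap.pi ca).prod (LinearMap.pi cb)).toAddMonoidHom.ker).relIndex
          (Λ ⊓ ((LinearMap.pi ca).prod (LinearMap.pi cb)).toAddMonoidHom.ker) := by
  set κ := ((LinearMap.pi ca).prod (LinearMap.pi cb)).toAddMonoidHom with hκ
  have h1 : Λ' ≤ Λ' ⊔ Λ ⊓ κ.ker := le_sup_left
  have h2 : Λ' ⊔ Λ ⊓ κ.ker ≤ Λ := sup_le hle inf_le_left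
  rw [← AddSubgroup.relIndex_mul_relIndex Λ' (Λ' ⊔ Λ ⊓ κ.ker) Λ h1 h2]
  have hA : Λ'.relIndex (Λ' ⊔ Λ ⊓ κ.ker) = (Λ' ⊓ κ.ker).relIndex (Λ ⊓ κ.ker) := by
    rw [AddSubgroup.relIndex_sup_left, ← AddSubgroup.inf_relIndex_right Λ' (Λ ⊓ κ.ker), ← inf_assoc,
      inf_of_le_left hle]
  have hB : (Λ' ⊔ Λ ⊓ κ.ker).relIndex Λ = (Λ'.map κ).relIndex (Λ.map κ) := by
    rw [sup_inf_ker_eq κ hle, AddSubgroup.inf_relIndex_left, AddSubgroup.relIndex_comap]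
  rw [hA, hB, hκ, map_prod_pi_eq haa hbb hab hba hΛ', map_prod_pi_eq haa hbb hab hba hΛ, relIndex_prod, sq,
    mul_comm]

end Index

end Summit.ABC.IUTFork.Thm311.TwistLattice
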